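import Summits.QuantumFields.YangMills.Theorems.ColdStartUniversalityLatticeLangevinGaugeCovarianceAlgebra
import Summits.QuantumFields.YangMills.Theorems.ColdStartUniversalityLatticeLangevinMeasurableFlow
import Mathlib.MeasureTheory.Integral.IntervalIntegral.Basic
import HarnessLib

/-!
# Route `ColdStartUniversality` (bricks «G4(ii), G4(iv-a)» of gauge covariance in law of the SZZ dynamics):
# the gauge-transformed path — matrix coordinates, measurability, continuity, and the conjugated drift integral

Helper file (seat `ym-line-csu-p1`, g10; `--supports stmt-QuantumFields-24809`).  For a lattice gauge transformation
`h : Site → SU(2)` and a configuration-valued process `U`: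

* `matrixConfig_gaugeTransform` — in matrix coordinates `Q = ρ ∘ U` the transformed configuration is the conjugated one of
  `GaugeCovariance`: `Q^h_e = ρ(h_x) Q_e ρ(h_{x+eᵢ})ᴴ`;
* `continuous_gaugeTransform`, `measurable_gaugeTransform_comp`, `continuous_gaugeTransform_path` — `gaugeTransform h` is continuous,
  so `h·U` is adapted to whatever `U` is adapted to and has continuous paths where `U` has;
* `intervalIntegral_conj_entry` — ★ conjugation by constant matrices commutes with the entrywise interval integral:
  `∫ₐᵇ (A M(s) B)_{ij} ds = (A (∫ₐᵇ M) B)_{ij}` for entrywise interval-integrable `M`; with `GaugeCovariance.drift_gauge` this is the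
  drift part `∫₀ᵗ b_e(Q^h_s) ds = ρ(h_x) (∫₀ᵗ b_e(Q_s) ds) ρ(h_{x+eᵢ})ᴴ` of the transfer of `IsSolution` (CSU lead memo §4 (iv-a)).

THEOREMS ONLY, [folklore]; no crux or summit is proved; the Yang–Mills mass gap is NOT proved.
-/

set_option autoImplicit false

noncomputable section

namespace Summit.QuantumFields.YangMills.Theorems.ColdStartUniversality.GaugeCovariance

open MeasureTheory Matrix
open scoped NNReal BigOperators
open Literature.MathematicalPhysics.QuantumFieldTheory

/-! ## Matrix coordinates of the gauge-transformed configuration -/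

section MatrixCoords

variable {G : Type*} [Group G] [TopologicalSpace G] (r : LatticeRep G) {d L : ℕ}

/-- **`Q^h = ρ ∘ (h·U)` is the conjugated configuration**: `ρ((h·U)_e) = ρ(h_x) ρ(U_e) ρ(h_{x+eᵢ})ᴴ`. [folklore] -/
theorem matrixConfig_gaugeTransform (h : Literature.MathematicalPhysics.QuantumFieldTheory.Site d L → G)
    (U : GaugeConfig d L G) :
    matrixConfig r.ρ (gaugeTransform h U) =
      fun e : Edge d L => r.ρ (h e.1) * matrixConfig r.ρ U e * (r.ρ (h (e.1.shift e.2)))ᴴ := by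
  funext e
  have rho_inv : ∀ g : G, r.ρ g⁻¹ = (r.ρ g)ᴴ := fun g =>
    calc r.ρ g⁻¹ = r.ρ g⁻¹ * (r.ρ g * (r.ρ g)ᴴ) := by rw [rho_mul_conjTranspose, mul_one]
      _ = r.ρ (g⁻¹ * g) * (r.ρ g)ᴴ := by rw [map_mul, mul_assoc]
      _ = (r.ρ g)ᴴ := by rw [inv_mul_cancel, map_one, one_mul]
  simp only [matrixConfig, gaugeTransform, map_mul, rho_inv]

end MatrixCoords

/-! ## Continuity / measurability of the gauge action on `SU(2)` configurations -/

section SU2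

variable {d L : ℕ}

/-- `gaugeTransform h` is continuous on `SU(2)`-configurations (finitely many products in a topological group). [folklore] -/
theorem continuous_gaugeTransform (h : Literature.MathematicalPhysics.QuantumFieldTheory.Site d L → Matrix.specialUnitaryGroup (Fin 2) ℂ) :
    Continuous (gaugeTransform h : GaugeConfig d L (Matrix.specialUnitaryGroup (Fin 2) ℂ) →
      GaugeConfig d L (Matrix.specialUnitaryGroup (Fin 2) ℂ)) := by
  refine continuous_pi fun e => ?_
  simp only [gaugeTransform]
  exact (continuous_const.mul (continuous_apply e)).mul continuous_const

/-- `h·U_t` is measurable for any σ-algebra on `Ω` for which `U_t` is (adaptedness transfers); `d = 3`, where the tree's Borel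
structure on `SU(2)`-configurations lives (`borelSpace_config`). [folklore] -/
theorem measurable_gaugeTransform_comp {L : ℕ} [NeZero L] {Ω : Type*} {mΩ' : MeasurableSpace Ω}
    (h : Literature.MathematicalPhysics.QuantumFieldTheory.Site 3 L → Matrix.specialUnitaryGroup (Fin 2) ℂ)
    {X : Ω → GaugeConfig 3 L (Matrix.specialUnitaryGroup (Fin 2) ℂ)} (hX : Measurable[mΩ'] X) :
    Measurable[mΩ'] fun ω => gaugeTransform h (X ω) := by
  haveI := secondCountableTopology_su2
  haveI := borelSpace_config L
  exact (continuous_gaugeTransform h).measurable.comp hX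

/-- `h·U` has continuous paths where `U` has. [folklore] -/
theorem continuous_gaugeTransform_path {Ω : Type*}
    (h : Literature.MathematicalPhysics.QuantumFieldTheory.Site d L → Matrix.specialUnitaryGroup (Fin 2) ℂ)
    {U : ℝ≥0 → Ω → GaugeConfig d L (Matrix.specialUnitaryGroup (Fin 2) ℂ)} {ω : Ω} (hU : Continuous fun t => U t ω) :
    Continuous fun t => gaugeTransform h (U t ω) :=
  (continuous_gaugeTransform h).comp hU

end SU2

/-! ## Conjugation by constant matrices commutes with the entrywise interval integral -/

section Integral

variable {N : ℕ}

/-- Entry of a two-sided product as a double sum. [folklore] -/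
theorem mul_mul_apply (A M B : Matrix (Fin N) (Fin N) ℂ) (i j : Fin N) :
    (A * M * B) i j = ∑ l, ∑ k, A i k * M k l * B l j := by
  simp only [Matrix.mul_apply, Finset.sum_mul]

/-- ★ **`∫ₐᵇ (A M(s) B)_{ij} ds = (A (∫ₐᵇ M) B)_{ij}`** for constant matrices `A, B` and an entrywise interval-integrable matrix path `M`.
[folklore] -/
theorem intervalIntegral_conj_entry (A B : Matrix (Fin N) (Fin N) ℂ) {M : ℝ → Matrix (Fin N) (Fin N) ℂ} {a b : ℝ}
    (hM : ∀ k l, IntervalIntegrable (fun s => M s k l) volume a b) (i j : Fin N) :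
    ∫ s in a..b, (A * M s * B) i j = (A * (Matrix.of fun k l => ∫ s in a..b, M s k l) * B) i j := by
  simp only [mul_mul_apply, Matrix.of_apply]
  have hint : ∀ k l, IntervalIntegrable (fun s => A i k * M s k l * B l j) volume a b := fun k l =>
    ((hM k l).const_mul _).mul_const _
  have hsum : ∀ l, IntervalIntegrable (fun s => ∑ k, A i k * M s k l * B l j) volume a b := by
    intro l
    have e : (fun s => ∑ k, A i k * M s k l * B l j) = ∑ k, (fun s => A i k * M s k l * B l j) := by
      funext s
      simp only [Finset.sum_apply]
    rw [e]
    exact IntervalIntegrable.sum _ fun k _ => hint k l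
  rw [intervalIntegral.integral_finsetSum fun l _ => hsum l]
  refine Finset.sum_congr rfl fun l _ => ?_
  rw [intervalIntegral.integral_finsetSum fun k _ => hint k l]
  refine Finset.sum_congr rfl fun k _ => ?_
  rw [intervalIntegral.integral_mul_const, intervalIntegral.integral_const_mul]

/-- The same along a CONTINUOUS matrix path (every entry is interval integrable). [folklore] -/
theorem intervalIntegral_conj_entry_of_continuous (A B : Matrix (Fin N) (Fin N) ℂ) {M : ℝ → Matrix (Fin N) (Fin N) ℂ}
    (hM : ∀ k l, Continuous fun s => M s k l) (a b : ℝ) (i j : Fin N) :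
    ∫ s in a..b, (A * M s * B) i j = (A * (Matrix.of fun k l => ∫ s in a..b, M s k l) * B) i j :=
  intervalIntegral_conj_entry A B (fun k l => (hM k l).intervalIntegrable a b) i j

end Integral

end Summit.QuantumFields.YangMills.Theorems.ColdStartUniversality.GaugeCovariance

end
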